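import Summits.BirchSwinnertonDyer.BirchSwinnertonDyer.Theorems.SylvesterTwoHeegnerIndexCoupledTelescopeClassSystemFlip
import Summits.BirchSwinnertonDyer.BirchSwinnertonDyer.Theorems.SylvesterTwoHeegnerIndexCoupledTelescopeBottomLinkHalved
import Summits.BirchSwinnertonDyer.BirchSwinnertonDyer.Theorems.SylvesterTwoHeegnerIndexCoupledTelescopeLevelDataHalved
import HarnessLib

/-!
# The COUPLED Cassels–Tate telescope, RESIDUE 7′ (VARIANT Q): the FLIPs with multiples for the rows' HALVED CLASS SYSTEM
# (RESIDUE 7′ l.87–98 shape; crux `UpperOffV0HSYPlus`, stmt-BirchSwinnertonDyer-19804), `p ≡ 7 (mod 9)`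
Skeleton VARIANT Q d342db51dc602551, stub `stub_residueSevenHalved`; planner D762 (3)/D793 (H-F).  The `p ≡ 7 (9)` twin of
S4b-2 `classSystem_flip_sylvesterPair` (p740182): from the defining equations of the HALVED class system (H-E
`exists_classSystemHalved_sylvesterPair`: the χ-sums run over the HALF index set `(𝒢₀⧸H) × H′` of the product representatives
`t`; `c′_B(1) = 2^{M₀} • δ x₀`), the two FLIP clauses for ALL square-free `ℓm`: the level pair `9pm ⊂ 9p(ℓm)` by (S2b)
`pairFlip_upper{A,B}_sylvesterTower` VERBATIM (stated for any index family), the bottom level data by H-A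
`levelDataHalved_sylvesterTower` (at `n₀ = 1`, the bottom involution `s` as the level fixing), and — for `m = 1` — the HALVED
BOTTOM LINK H-D `bottomLink_halved_sylvesterPair` (THEOREM C; `Y^tr = 2 • (2^{M₀} • x₀ + T)`; the half point of HSY's `Y₁`).
* ★ `classSystemHalved_flip_sylvesterPair` — RESIDUE 7′ l.87–92 ∧ l.93–98 for the halved class system.
Theorems only (no definition / named fact / instance / notation); CONDITIONAL on THEOREM C (`hC`) and the displayed bottom
involution / half-fixer data; nothing asserted on 19804; no stub closed on the ledger; X12.CMAtTwo NOT proved; BSD not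
claimed for any curve.  Sources: [GrossLMS1991] §3 Prop. 3.7, §4, Prop. 6.2; [McCallumLMS1991] Prop. 4.4, §4–§5;
[Nekovar2007] Prop. 4.9; [HuShuYin2019] §2, §4.1, Thm. C; memo g44 §4 (iv).  `lean search 'classSystemHalved_flip'` → nothing.
-/

set_option linter.dupNamespace false -- Summits modules are `Summit.<Summit>.<Problem>…` by design
set_option autoImplicit false

noncomputable section

open scoped Classical Pointwise

namespace Summit.BirchSwinnertonDyer.BirchSwinnertonDyer.Theorems.SylvesterTwoCMFlip

open WeierstrassCurve WeierstrassCurve.Affine WeierstrassCurve.Affine.Point Field NumberField IsDedekindDomain Finset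
open Literature.NumberTheory.EllipticCurves Literature.NumberTheory.GaloisRepresentations
  Literature.NumberTheory.EllipticCurves.ModularForms
  Literature.NumberTheory.EllipticCurves.HuShuYin2019
  Literature.NumberTheory.EllipticCurves.KolyvaginCocycle
  Literature.NumberTheory.EllipticCurves.KolyvaginDescent
  Literature.NumberTheory.EllipticCurves.RingClassField
  Summit.BirchSwinnertonDyer.BirchSwinnertonDyer.Theorems.SylvesterTwoCMData
  Summit.BirchSwinnertonDyer.BirchSwinnertonDyer.Theorems.SylvesterTwoCMHalf
  Summit.BirchSwinnertonDyer.BirchSwinnertonDyer.Theorems.SylvesterTwoCoupledTelescope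
  Summit.BirchSwinnertonDyer.BirchSwinnertonDyer.Theses.SylvesterTwoHeegnerIndex
  Summit.BirchSwinnertonDyer.Rank1Residual.X11b
  Summit.BirchSwinnertonDyer.Rank1Residual.X11b.RingClassTower

variable {K : Type} [Field K] [NumberField K]

set_option maxHeartbeats 1600000 in
/-- ★ **THE TWO FLIPs WITH MULTIPLES for the HALVED class system `c′_A, c′_B`, `p ≡ 7 (mod 9)`** (RESIDUE 7′ l.87–98, all
square-free `ℓm`, `ℓ` a Kolyvagin prime of the level): from the halved class system's defining equations, the coherent
global choices, the half-fixer / bottom-involution data, and — at `m = 1` — the HALVED bottom link to `c′_B(1) = 2^{M₀} • δ x₀`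
(THEOREM C). [cite: GrossLMS1991, §3 (3.5), Prop. 3.7, Prop. 6.2 (2), §4] [cite: McCallumLMS1991, Prop. 4.4, §4 (4)–(6), §5]
[cite: HuShuYin2019, §2 Prop. 2.4, §3 p. 8, §4.1, Thm. C] [cite: Nekovar2007, Prop. 4.9, Prop. 4.13 (ii)] -/
theorem classSystemHalved_flip_sylvesterPair {ω : K} (hω : ω ^ 2 + ω + 1 = 0) (h2 : Module.finrank ℚ K = 2)
    (ι : K →+* ℂ) (Dt : ModularParametrizationData (⟨0, 0, 1, 0, -1⟩ : WeierstrassCurve ℚ) 243)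
    {p : ℕ} (hp : p.Prime) (h9 : p % 9 = 7) (κ : ℕ) (hκ : 1 ≤ κ)
    -- the Kolyvagin-prime predicate, (T3-II)'s shape
    {NA NB : ℕ} (hNAc : (cubeSumCurve (3 * (p : ℚ) ^ 2)).conductorNorm ℤ ∣ NA)
    (hNBc : (cubeSumCurve (p : ℚ)).conductorNorm ℤ ∣ NB) (b₀ : ℕ) (Kol : ℕ → Prop)
    (hKol : ∀ ℓ, Kol ℓ ↔ (ℓ.Prime ∧ ¬ ℓ ∣ NA ∧ ¬ ℓ ∣ NB ∧ ¬ ((ℓ : ℤ) ∣ NumberField.discr K) ∧ ℓ ≠ 2 ∧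
      (Ideal.span {(ℓ : 𝓞 K)}).IsPrime ∧ FrobEqFrobInfty (cubeSumCurve (3 * (p : ℚ) ^ 2)) K (2 ^ κ * 2 ^ κ) ℓ ∧
      FrobEqFrobInfty (cubeSumCurve (p : ℚ)) K (2 ^ κ * 2 ^ κ) ℓ ∧ b₀ < ℓ))
    -- the bottom class `2^{M₀} • δ x₀`
    (M₀ : ℕ) (x₀ : ((cubeSumCurve (p : ℚ)).baseChange K).toAffine.Point)
    -- global choices: coherent embeddings, point maps, fixers, CM points, coherent generators
    (emb : (m : ℕ) → (ringClassField K ι m →+* AlgebraicClosure K))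
    (hemb : ∀ (m : ℕ) (k : K), emb m (algebraMap K (ringClassField K ι m) k) = algebraMap K (AlgebraicClosure K) k)
    (hcoh : ∀ (m n : ℕ) (h : ringClassField K ι m ≤ ringClassField K ι n) (x : ringClassField K ι m), emb n (RingClassField.inclusion ι h x) = emb m x)
    (ιe : (n : ℕ) → (letI : DecidableEq (ringClassField K ι (9 * p * n)) := fun a b ↦ Classical.propDecidable (a = b)
      ((⟨0, 0, 1, 0, -1⟩ : WeierstrassCurve ℚ).baseChange (ringClassField K ι (9 * p * n))).toAffine.Point →+
        geomPoints ((⟨0, 0, 1, 0, -1⟩ : WeierstrassCurve ℚ).baseChange K)))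
    (hιe : ∀ n P, ιe n P = Affine.Point.map (W' := (⟨0, 0, 1, 0, -1⟩ : WeierstrassCurve ℚ)) (emb (9 * p * n)).toRatAlgHom P)
    (Nf : ℕ → Subgroup (absoluteGaloisGroup K))
    (hNf : ∀ (m : ℕ) (g : absoluteGaloisGroup K), g ∈ Nf m ↔
      ∀ x : ringClassField K ι m, (show AlgebraicClosure K ≃ₐ[K] AlgebraicClosure K from g) (emb m x) = emb m x)
    (y : (n : ℕ) → ((⟨0, 0, 1, 0, -1⟩ : WeierstrassCurve ℚ).baseChange (ringClassField K ι (9 * p * n))).toAffine.Point)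
    (hy : ∀ n, n ≠ 0 → (∀ q ∈ n.primeFactors, q % 3 = 2) →
      Affine.Point.map (W' := (⟨0, 0, 1, 0, -1⟩ : WeierstrassCurve ℚ)) (ringClassField K ι (9 * p * n)).subtype.toRatAlgHom (y n) =
        Dt.φ (heegnerTau ((n : ℤ) ^ 2 * (81 * ((p : ℤ) ^ 2 + 4 * p + 16)), (n : ℤ) * (-(9 * (4 * (p : ℤ) ^ 2 + 17 * p + 72))), 4 * (p : ℤ) ^ 2 + 18 * p + 81)))
    (σ : (n q : ℕ) → (ringClassField K ι (9 * p * n) ≃ₐ[ℚ] ringClassField K ι (9 * p * n)))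
    (hσgen : ∀ n q, n ≠ 0 → q.Prime → ¬ q ∣ 9 * p → (Ideal.span {(q : 𝓞 K)}).IsPrime → q ∣ n → ¬ q ∣ n / q →
      Subgroup.zpowers (σ n q) = ringClassGalOver ι (9 * p * n) (9 * p * n / q))
    -- the frame transport `E₉(K̄) ≃+ W₀(K̄)` and the coupled frame (`exists_coupledFrame`)
    (κ₉ : geomPoints ((cubeSumCurve 9).baseChange K) ≃+ geomPoints ((⟨0, 0, 1, 0, -1⟩ : WeierstrassCurve ℚ).baseChange K))
    (hκG : ∀ (g : absoluteGaloisGroup K) (P : geomPoints ((cubeSumCurve 9).baseChange K)), κ₉ (g • P) = g • κ₉ P)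
    {vB vA : AlgebraicClosure K} (hvBc : vB ^ 3 = algebraMap ℚ (AlgebraicClosure K) ((p : ℚ) / 9))
    (hvB : vB ≠ 0) (hvAc : vA ^ 3 = algebraMap ℚ (AlgebraicClosure K) ((p : ℚ) ^ 2 / 3)) (hvA0 : vA ≠ 0)
    (hvB3 : ∀ g : absoluteGaloisGroup K, ((show AlgebraicClosure K ≃ₐ[K] AlgebraicClosure K from g) vB) ^ 3 = vB ^ 3)
    (hvA3 : ∀ g : absoluteGaloisGroup K, ((show AlgebraicClosure K ≃ₐ[K] AlgebraicClosure K from g) vA) ^ 3 = vA ^ 3)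
    {ψB : geomPoints ((cubeSumCurve 9).baseChange K) ≃+ geomPoints ((cubeSumCurve (p : ℚ)).baseChange K)}
    {ψA : geomPoints ((cubeSumCurve 9).baseChange K) ≃+ geomPoints ((cubeSumCurve (3 * (p : ℚ) ^ 2)).baseChange K)}
    (hψB : ∀ {x y : AlgebraicClosure K} (h : (((cubeSumCurve 9).baseChange K).baseChange (AlgebraicClosure K)).toAffine.Nonsingular x y),
      ∃ h', ψB (Affine.Point.some x y h) = Affine.Point.some (vB ^ 2 * x) (vB ^ 3 * y) h')
    (hψA : ∀ {x y : AlgebraicClosure K} (h : (((cubeSumCurve 9).baseChange K).baseChange (AlgebraicClosure K)).toAffine.Nonsingular x y),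
      ∃ h', ψA (Affine.Point.some x y h) = Affine.Point.some (vA ^ 2 * x) (vA ^ 3 * y) h')
    {ρ : absoluteGaloisGroup K → geomPoints ((cubeSumCurve 9).baseChange K) ≃+ geomPoints ((cubeSumCurve 9).baseChange K)}
    (hρ : ∀ (g : absoluteGaloisGroup K) {x y : AlgebraicClosure K}
        (h : (((cubeSumCurve 9).baseChange K).baseChange (AlgebraicClosure K)).toAffine.Nonsingular x y), ∃ h', ρ g (Affine.Point.some x y h) =
          Affine.Point.some (((show AlgebraicClosure K ≃ₐ[K] AlgebraicClosure K from g) vB / vB) ^ 2 * x) y h')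
    (hρρ : ∀ (g : absoluteGaloisGroup K) {x y : AlgebraicClosure K}
        (h : (((cubeSumCurve 9).baseChange K).baseChange (AlgebraicClosure K)).toAffine.Nonsingular x y), ∃ h', ρ g (ρ g (Affine.Point.some x y h)) =
          Affine.Point.some (((show AlgebraicClosure K ≃ₐ[K] AlgebraicClosure K from g) vA / vA) ^ 2 * x) y h')
    (hlawB : ∀ (g : absoluteGaloisGroup K) (P : geomPoints ((cubeSumCurve 9).baseChange K)), g • ψB P = ψB (ρ g (g • P)))
    (hlawA : ∀ (g : absoluteGaloisGroup K) (P : geomPoints ((cubeSumCurve 9).baseChange K)), g • ψA P = ψA (ρ g (ρ g (g • P))))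
    -- the bottom fixer and transversal (`exists_bottom_transversal` at `emb (9 * p)`)
    (N₀ : Subgroup (absoluteGaloisGroup K))
    (hN₀ : ∀ g : absoluteGaloisGroup K, g ∈ N₀ ↔
      ∀ x : ringClassField K ι (9 * p), (show AlgebraicClosure K ≃ₐ[K] AlgebraicClosure K from g) (emb (9 * p) x) = emb (9 * p) x)
    (hES2 : Nekovar2007.cmPoint_frobeniusCongruence)
    (hσgal : ∀ n q, σ n q ∈ ringClassGal ι (9 * p * n))
    (hσcompat : ∀ (n n' q : ℕ), n ≠ 0 → n' ≠ 0 → ∀ (h : ringClassField K ι (9 * p * n) ≤ ringClassField K ι (9 * p * n'))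
      (x : ringClassField K ι (9 * p * n)), σ n' q (RingClassField.inclusion ι h x) = RingClassField.inclusion ι h (σ n q x))
    (hρcomm : ∀ (g h : absoluteGaloisGroup K) (P : geomPoints ((cubeSumCurve 9).baseChange K)), h • ρ g P = ρ g (h • P))
    (hκ : ∀ {x y : AlgebraicClosure K} (h : (((cubeSumCurve (9 : ℚ)).baseChange K).baseChange (AlgebraicClosure K)).toAffine.Nonsingular x y),
      ∃ h', κ₉ (Affine.Point.some x y h) = Affine.Point.some (x / 36) ((y - 108) / 216) h')
    -- the BOTTOM LINK's inputs (RESIDUE 4's bottom binders, the named display #19, the level-`9p` point map,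
    -- the cube roots / stabiliser / lifts of the PRODUCT transversal `t`, the display's CM operator on `B_K`)
    (hF : PublishedFactsTwoPlus) (hD : shaAnPair_mul_height_eq_two_zpow_mul_height_named) (hdeg : Dt.deg = 6)
    (hC : SylvesterTwoNonneg.HSYPointTwoDivisibleSevenModNine)
    (h3 : ¬ ∃ x : ZMod p, x ^ 3 = 3)
    (A B : WeierstrassCurve ℚ) [A.IsElliptic] [A.IsGloballyMinimal] [B.IsElliptic] [B.IsGloballyMinimal]
    (hA : ∃ C : VariableChange ℚ, C • A = HuShuYin2019.cubeSumCurve (3 * (p : ℚ) ^ 2))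
    (qB qA : ℚ) (hqB : shaAn B = (qB : ℂ)) (hqA : shaAn A = (qA : ℂ)) (hne : qB * qA ≠ 0)
    (CB : VariableChange ℚ) (hCB : CB • B = HuShuYin2019.cubeSumCurve (p : ℚ))
    (P : B.toAffine.Point) (Y : (B.baseChange K).toAffine.Point)
    (hPinf : ¬ IsOfFinAddOrder (WeierstrassCurve.QuadraticDescent.incl K B P))
    (hPgen : ∀ Q : B.toAffine.Point, ∃ m : ℤ, IsOfFinAddOrder (WeierstrassCurve.QuadraticDescent.incl K B Q - m • WeierstrassCurve.QuadraticDescent.incl K B P))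
    (hht : ((qB * qA : ℚ) : ℝ) * canonicalHeight (WeierstrassCurve.QuadraticDescent.incl K B P) =
      (2 : ℝ) ^ (if p % 9 = 4 then (0 : ℤ) else -2) * canonicalHeight Y)
    {T : ((cubeSumCurve (p : ℚ)).baseChange K).toAffine.Point} (hT : IsOfFinAddOrder T)
    (hY : Affine.Point.congrEquiv (congrArg (fun W : WeierstrassCurve ℚ ↦ W.baseChange K) hCB)
      (VariableChange.pointEquivBaseChange B CB K Y) = (2 : ℤ) • (((2 ^ M₀ : ℕ) : ℤ) • x₀ + T))
    (y₁ : ((⟨0, 0, 1, 0, -1⟩ : WeierstrassCurve ℚ).baseChange (ringClassField K ι (9 * p))).toAffine.Point)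
    (hy₁ : Affine.Point.map (W' := (⟨0, 0, 1, 0, -1⟩ : WeierstrassCurve ℚ)) (ringClassField K ι (9 * p)).subtype.toRatAlgHom y₁ =
      Dt.φ (heegnerTau (81 * ((p : ℤ) ^ 2 + 4 * p + 16), -(9 * (4 * (p : ℤ) ^ 2 + 17 * p + 72)), 4 * (p : ℤ) ^ 2 + 18 * p + 81)))
    (ιe₀ : letI : DecidableEq (ringClassField K ι (9 * p)) := fun a b ↦ Classical.propDecidable (a = b)
      ((⟨0, 0, 1, 0, -1⟩ : WeierstrassCurve ℚ).baseChange (ringClassField K ι (9 * p))).toAffine.Point →+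
        geomPoints (((⟨0, 0, 1, 0, -1⟩ : WeierstrassCurve ℚ)).baseChange K))
    (hιe₀ : ∀ Q, ιe₀ Q = Affine.Point.map (W' := (⟨0, 0, 1, 0, -1⟩ : WeierstrassCurve ℚ)) (emb (9 * p)).toRatAlgHom Q)
    {c₃ cp : ringClassField K ι (9 * p)} (hc₃ : c₃ ^ 3 = 3) (hcp : cp ^ 3 = (p : ringClassField K ι (9 * p)))
    (H : Subgroup (ringClassField K ι (9 * p) ≃ₐ[K] ringClassField K ι (9 * p)))
    (hH : ∀ s, s ∈ H ↔ s c₃ = c₃ ∧ s cp = cp)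
    [Fintype ((ringClassField K ι (9 * p) ≃ₐ[K] ringClassField K ι (9 * p)) ⧸ H)] [Fintype H]
    (Tl : (ringClassField K ι (9 * p) ≃ₐ[K] ringClassField K ι (9 * p)) → absoluteGaloisGroup K)
    (hTl : ∀ s (x : ringClassField K ι (9 * p)), (show AlgebraicClosure K ≃ₐ[K] AlgebraicClosure K from Tl s) (emb (9 * p) x) = emb (9 * p) (s x))
    (t : ((ringClassField K ι (9 * p) ≃ₐ[K] ringClassField K ι (9 * p)) ⧸ H) × H → absoluteGaloisGroup K)
    (ht' : ∀ q h, t (q, h) = Tl (Quotient.out q) * Tl (h : _))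
    (ht : Function.Bijective fun i ↦ (t i : absoluteGaloisGroup K ⧸ N₀))
    -- THE BOTTOM INVOLUTION / HALF FIXER DATA (`exists_halfFixer`; (W2-b) at `n = 1` displayed as `hsy`)
    (s : H) (hs2 : s * s = 1) (H' : Finset H) (hH' : ∀ h : H, Xor (h ∈ H') (h * s ∈ H'))
    (hsy : pointGalHom (⟨0, 0, 1, 0, -1⟩ : WeierstrassCurve ℚ) (ringClassField K ι (9 * p)) ((s : _ ≃ₐ[K] _).restrictScalars ℚ) y₁ = y₁)
    (N'' : Subgroup (absoluteGaloisGroup K)) (hN''₀ : ∀ g ∈ N₀, g ∈ N'')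
    (hdich : ∀ g ∈ N'', (∀ x : ringClassField K ι (9 * p), (show AlgebraicClosure K ≃ₐ[K] AlgebraicClosure K from g) (emb (9 * p) x) = emb (9 * p) x) ∨
      (∀ x : ringClassField K ι (9 * p), (show AlgebraicClosure K ≃ₐ[K] AlgebraicClosure K from g) (emb (9 * p) x) =
          emb (9 * p) ((s : ringClassField K ι (9 * p) ≃ₐ[K] ringClassField K ι (9 * p)) x)))
    (hN''vB : ∀ g ∈ N'', (show AlgebraicClosure K ≃ₐ[K] AlgebraicClosure K from g) vB = vB)
    (hN''vA : ∀ g ∈ N'', (show AlgebraicClosure K ≃ₐ[K] AlgebraicClosure K from g) vA = vA)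
    (ht'' : Function.Bijective fun i : ((ringClassField K ι (9 * p) ≃ₐ[K] ringClassField K ι (9 * p)) ⧸ H) × H' ↦
      (t (i.1, (i.2 : H)) : absoluteGaloisGroup K ⧸ N''))
    (φB : Isogeny ((cubeSumCurve (p : ℚ)).baseChange K) ((cubeSumCurve (p : ℚ)).baseChange K))
    (fnB : geomTorsion ((cubeSumCurve (p : ℚ)).baseChange K) ((2 ^ κ * 2 ^ κ : ℕ) : ℤ) →+
      geomTorsion ((cubeSumCurve (p : ℚ)).baseChange K) ((2 ^ κ * 2 ^ κ : ℕ) : ℤ))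
    (hfnB : ∀ (g : absoluteGaloisGroup K) (Q : geomTorsion ((cubeSumCurve (p : ℚ)).baseChange K) ((2 ^ κ * 2 ^ κ : ℕ) : ℤ)),
      fnB (ContinuousMonoidHom.id _ g • Q) = g • fnB Q)
    (hφB : ∀ (x y : AlgebraicClosure K) (h : (((cubeSumCurve (p : ℚ)).baseChange K).baseChange (AlgebraicClosure K)).toAffine.Nonsingular x y),
      ∃ h', φB (Affine.Point.some x y h) = Affine.Point.some (algebraMap K (AlgebraicClosure K) ω ^ 2 * x) (algebraMap K (AlgebraicClosure K) ω ^ 3 * y) h')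
    (hcoeB : ∀ Q : geomTorsion ((cubeSumCurve (p : ℚ)).baseChange K) ((2 ^ κ * 2 ^ κ : ℕ) : ℤ),
      ((fnB Q : geomTorsion ((cubeSumCurve (p : ℚ)).baseChange K) ((2 ^ κ * 2 ^ κ : ℕ) : ℤ)) : geomPoints ((cubeSumCurve (p : ℚ)).baseChange K)) = φB Q)
    -- the class system of `exists_classSystem_sylvesterPair` (its defining equations)
    (Pt : ℕ → geomPoints ((cubeSumCurve 9).baseChange K))
    (hPt : ∀ n, Pt n = κ₉.symm (ιe n (((n.primeFactors.sort (· ≤ ·)).map fun q ↦ (σ n q, q)).foldr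
        (fun b z ↦ KolyvaginOperator.derivOp (pointGalHom (⟨0, 0, 1, 0, -1⟩ : WeierstrassCurve ℚ) (ringClassField K ι (9 * p * n))) b.1 b.2 z) (y n))))
    (hLD : ∀ n, KolSupp Kol n → Pt n ∈ FixedPoints.addSubgroup (Nf (9 * p * n)) (geomPoints ((cubeSumCurve 9).baseChange K)) ∧
        (Nf (9 * p * n)).Normal ∧ (∀ h ∈ Nf (9 * p * n), (show AlgebraicClosure K ≃ₐ[K] AlgebraicClosure K from h) vB = vB) ∧
        (∀ h ∈ N₀, ∃ a ∈ FixedPoints.addSubgroup (Nf (9 * p * n)) (geomPoints ((cubeSumCurve 9).baseChange K)),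
          ((2 ^ κ * 2 ^ κ : ℕ) : ℤ) • a = h • Pt n - Pt n) ∧
        (∀ h ∈ N'', ∃ a ∈ FixedPoints.addSubgroup (Nf (9 * p * n)) (geomPoints ((cubeSumCurve 9).baseChange K)),
          ((2 ^ κ * 2 ^ κ : ℕ) : ℤ) • a = h • Pt n - Pt n))
    (cA : ℕ → galH1Torsion ((cubeSumCurve (3 * (p : ℚ) ^ 2)).baseChange K) ((2 ^ κ * 2 ^ κ : ℕ) : ℤ))
    (cB : ℕ → galH1Torsion ((cubeSumCurve (p : ℚ)).baseChange K) ((2 ^ κ * 2 ^ κ : ℕ) : ℤ))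
    (hcA : ∀ n, KolSupp Kol n → ∃ (hA : IsAdmissible (absoluteGaloisGroup K)
          ((FixedPoints.addSubgroup (Nf (9 * p * n)) (geomPoints ((cubeSumCurve 9).baseChange K))).map ψA.toAddMonoidHom) ((2 ^ κ * 2 ^ κ : ℕ) : ℤ))
        (hP : ψA (∑ i : ((ringClassField K ι (9 * p) ≃ₐ[K] ringClassField K ι (9 * p)) ⧸ H) × H',
          ρ (t (i.1, (i.2 : H))) (ρ (t (i.1, (i.2 : H))) (t (i.1, (i.2 : H)) • Pt n))) ∈ invPoints (absoluteGaloisGroup K)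
          ((FixedPoints.addSubgroup (Nf (9 * p * n)) (geomPoints ((cubeSumCurve 9).baseChange K))).map ψA.toAddMonoidHom) ((2 ^ κ * 2 ^ κ : ℕ) : ℤ)),
        cA n = kolyvaginClass ((cubeSumCurve (3 * (p : ℚ) ^ 2)).baseChange K) ((2 ^ κ * 2 ^ κ : ℕ) : ℤ)
          (((cubeSumCurve (3 * (p : ℚ) ^ 2)).baseChange K).zsmul_geomPoints_surjective_of_charZero
            (Int.natCast_ne_zero.mpr (mul_ne_zero (pow_ne_zero κ two_ne_zero) (pow_ne_zero κ two_ne_zero))))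
          hA (ψA (∑ i : ((ringClassField K ι (9 * p) ≃ₐ[K] ringClassField K ι (9 * p)) ⧸ H) × H',
          ρ (t (i.1, (i.2 : H))) (ρ (t (i.1, (i.2 : H))) (t (i.1, (i.2 : H)) • Pt n)))) hP)
    (hcB : ∀ n, KolSupp Kol n → n ≠ 1 → ∃ (hA : IsAdmissible (absoluteGaloisGroup K)
          ((FixedPoints.addSubgroup (Nf (9 * p * n)) (geomPoints ((cubeSumCurve 9).baseChange K))).map ψB.toAddMonoidHom) ((2 ^ κ * 2 ^ κ : ℕ) : ℤ))
        (hP : ψB (∑ i : ((ringClassField K ι (9 * p) ≃ₐ[K] ringClassField K ι (9 * p)) ⧸ H) × H',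
          ρ (t (i.1, (i.2 : H))) (t (i.1, (i.2 : H)) • Pt n)) ∈ invPoints (absoluteGaloisGroup K)
          ((FixedPoints.addSubgroup (Nf (9 * p * n)) (geomPoints ((cubeSumCurve 9).baseChange K))).map ψB.toAddMonoidHom) ((2 ^ κ * 2 ^ κ : ℕ) : ℤ)),
        cB n = kolyvaginClass ((cubeSumCurve (p : ℚ)).baseChange K) ((2 ^ κ * 2 ^ κ : ℕ) : ℤ)
          (((cubeSumCurve (p : ℚ)).baseChange K).zsmul_geomPoints_surjective_of_charZero
            (Int.natCast_ne_zero.mpr (mul_ne_zero (pow_ne_zero κ two_ne_zero) (pow_ne_zero κ two_ne_zero))))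
          hA (ψB (∑ i : ((ringClassField K ι (9 * p) ≃ₐ[K] ringClassField K ι (9 * p)) ⧸ H) × H', ρ (t (i.1, (i.2 : H))) (t (i.1, (i.2 : H)) • Pt n))) hP)
    (hcB1 : cB 1 = ((2 : ℤ) ^ M₀) • kummerMapTorsion ((cubeSumCurve (p : ℚ)).baseChange K) ((2 ^ κ * 2 ^ κ : ℕ) : ℤ)
        (((cubeSumCurve (p : ℚ)).baseChange K).zsmul_geomPoints_surjective_of_charZero
          (Int.natCast_ne_zero.mpr (mul_ne_zero (pow_ne_zero κ two_ne_zero) (pow_ne_zero κ two_ne_zero)))) x₀) :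
    -- (T-L1) the two FLIPs with multiples (RESIDUE c v3 l.87–98)
    (∀ ℓ m, Kol ℓ → KolSupp Kol (ℓ * m) → Even m.primeFactors.card → ∀ v : HeightOneSpectrum (𝓞 K), (ℓ : 𝓞 K) ∈ v.asIdeal → ∀ a : ℕ,
      (((2 : ℤ) ^ a) • cA (ℓ * m) ∈ selmerLocalKer ((cubeSumCurve (3 * (p : ℚ) ^ 2)).baseChange K) (v.adicCompletion K) ((2 ^ κ * 2 ^ κ : ℕ) : ℤ) ↔
        ((2 : ℤ) ^ a) • cB m ∈ ((cubeSumCurve (p : ℚ)).baseChange K).torsionLocalKer (v.adicCompletion K) ((2 ^ κ * 2 ^ κ : ℕ) : ℤ))) ∧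
    (∀ ℓ m, Kol ℓ → KolSupp Kol (ℓ * m) → Odd m.primeFactors.card → ∀ v : HeightOneSpectrum (𝓞 K), (ℓ : 𝓞 K) ∈ v.asIdeal → ∀ a : ℕ,
      (((2 : ℤ) ^ a) • cB (ℓ * m) ∈ selmerLocalKer ((cubeSumCurve (p : ℚ)).baseChange K) (v.adicCompletion K) ((2 ^ κ * 2 ^ κ : ℕ) : ℤ) ↔
        ((2 : ℤ) ^ a) • cA m ∈ ((cubeSumCurve (3 * (p : ℚ) ^ 2)).baseChange K).torsionLocalKer (v.adicCompletion K) ((2 ^ κ * 2 ^ κ : ℕ) : ℤ))) := by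
  have hK := JZero.isImaginaryQuadratic_of_sq_add_self_add_one hω h2
  have hp3 : p % 3 = 1 := by omega
  have hp0 : p ≠ 0 := hp.ne_zero
  have h9p : 9 * p ≠ 0 := mul_ne_zero (by norm_num) hp0
  haveI := isElliptic_sylvesterNineMinimal
  haveI := isGloballyMinimal_sylvesterNineMinimal
  have hlev : 2 ^ κ * 2 ^ κ = 2 ^ (2 * κ) := by rw [two_mul, pow_add]
  have hM : 1 ≤ 2 * κ := by omega
  -- the derived points, substituted
  have ePt := funext hPt
  subst ePt
  -- the frame transport in the `(a, b, d)` form of (S2)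
  have hκ' : ∀ {x y : AlgebraicClosure K}
      (h : (((cubeSumCurve 9).baseChange K).baseChange (AlgebraicClosure K)).toAffine.Nonsingular x y),
      ∃ h', κ₉ (Affine.Point.some x y h) =
        Affine.Point.some ((36 : AlgebraicClosure K)⁻¹ * x) ((216 : AlgebraicClosure K)⁻¹ * y + -(108 / 216)) h' := by
    intro x y h
    obtain ⟨h', e⟩ := hκ h
    have ex : x / 36 = (36 : AlgebraicClosure K)⁻¹ * x := by rw [div_eq_mul_inv, mul_comm]
    have ey : (y - 108) / 216 = (216 : AlgebraicClosure K)⁻¹ * y + -(108 / 216) := by ring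
    simp only [ex, ey] at e
    exact ⟨_, e⟩
  -- ### what `Kol q` gives for a prime `q`
  have hKolq : ∀ q, Kol q → q.Prime ∧ q % 3 = 2 ∧ q ≠ 2 ∧ ¬ q ∣ 9 * p ∧ (Ideal.span {(q : 𝓞 K)}).IsPrime ∧
      ¬ q ∣ (cubeSumCurve (3 * (p : ℚ) ^ 2)).conductorNorm ℤ ∧ ¬ q ∣ (cubeSumCurve (p : ℚ)).conductorNorm ℤ ∧
      ¬ ((q : ℤ) ∣ NumberField.discr K) ∧ FrobEqFrobInfty (cubeSumCurve (3 * (p : ℚ) ^ 2)) K (2 ^ κ * 2 ^ κ) q ∧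
      FrobEqFrobInfty (cubeSumCurve (p : ℚ)) K (2 ^ κ * 2 ^ κ) q := by
    intro q hq
    obtain ⟨hqp, hqA, hqB, hqd, hq2, hqP, hFA, hFB, -⟩ := (hKol q).mp hq
    have hFB2 : FrobEqFrobInfty (cubeSumCurve (p : ℚ)) K 2 q :=
      FrobEqFrobInfty.of_dvd (W := cubeSumCurve (p : ℚ)) (K := K) ((dvd_pow_self 2 (by omega : κ ≠ 0)).mul_right _) hFB
    obtain ⟨hq3, hqp'⟩ := mod_three_eq_two_of_clause hω h2 hp hp3 hqp hqd hFB2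
    have hq9p : ¬ q ∣ 9 * p := fun h ↦ by
      rcases (Nat.Prime.dvd_mul hqp).mp h with h9' | h'
      · have : q ∣ 3 := hqp.dvd_of_dvd_pow (by norm_num at h9' ⊢; exact h9' : q ∣ 3 ^ 2)
        have := (Nat.prime_dvd_prime_iff_eq hqp Nat.prime_three).mp this
        omega
      · exact hqp' h'
    exact ⟨hqp, hq3, hq2, hq9p, hqP, fun h ↦ hqA (h.trans hNAc), fun h ↦ hqB (h.trans hNBc), hqd, hFA, hFB⟩
  -- ### square-free levels `ℓm`
  have hsplit : ∀ ℓ m, Kol ℓ → KolSupp Kol (ℓ * m) →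
      m ≠ 0 ∧ ¬ ℓ ∣ m ∧ KolSupp Kol m ∧ (∀ q ∈ m.primeFactors, q % 3 = 2) ∧
      (∀ q ∈ (ℓ * m).primeFactors, q % 3 = 2) ∧ (ℓ * m).primeFactors = insert ℓ m.primeFactors := by
    rintro ℓ m hℓ ⟨hsq, hkol⟩
    have hℓp := (hKolq ℓ hℓ).1
    have hm0 : m ≠ 0 := fun h ↦ hsq.ne_zero (by rw [h, mul_zero])
    have hℓm : ¬ ℓ ∣ m := fun h ↦ hℓp.one_lt.ne' (Nat.isUnit_iff.mp (hsq ℓ (mul_dvd_mul_left ℓ h)))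
    have hsub : m.primeFactors ⊆ (ℓ * m).primeFactors := Nat.primeFactors_mono (dvd_mul_left m ℓ) hsq.ne_zero
    refine ⟨hm0, hℓm, ⟨hsq.of_mul_right, fun q hq ↦ hkol q (hsub hq)⟩, fun q hq ↦ (hKolq q (hkol q (hsub hq))).2.1,
      fun q hq ↦ (hKolq q (hkol q hq)).2.1, ?_⟩
    rw [Nat.primeFactors_mul hℓp.ne_zero hm0, hℓp.primeFactors, Finset.insert_eq]
  -- ### the top level `9p(ℓm)`: the generator `σ_ℓ`, the list `l(ℓm) ~ (σ_ℓ, ℓ) :: (lift of l(m))`, (ES1)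
  have htop : ∀ ℓ m, Kol ℓ → KolSupp Kol (ℓ * m) →
      Subgroup.zpowers (σ (ℓ * m) ℓ) = ringClassGalOver ι (9 * p * (ℓ * m)) (9 * p * m) ∧
      (((ℓ * m).primeFactors.sort (· ≤ ·)).map fun q ↦ (σ (ℓ * m) q, q)).Perm
        ((σ (ℓ * m) ℓ, ℓ) :: ((m.primeFactors.sort (· ≤ ·)).map fun q ↦ (σ (ℓ * m) q, q))) ∧
      (∀ a ∈ (((ℓ * m).primeFactors.sort (· ≤ ·)).map fun q ↦ (σ (ℓ * m) q, q)),
        ∀ b ∈ (((ℓ * m).primeFactors.sort (· ≤ ·)).map fun q ↦ (σ (ℓ * m) q, q)), Commute a.1 b.1) ∧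
      (∀ a ∈ (((ℓ * m).primeFactors.sort (· ≤ ·)).map fun q ↦ (σ (ℓ * m) q, q)),
        a.1 ∈ ringClassGal ι (9 * p * (ℓ * m))) ∧
      ∑ i ∈ Finset.range (ℓ + 1), pointGalHom (⟨0, 0, 1, 0, -1⟩ : WeierstrassCurve ℚ) (ringClassField K ι (9 * p * (ℓ * m)))
        (σ (ℓ * m) ℓ ^ i) (y (ℓ * m)) = 0 := by
    intro ℓ m hℓ hℓm
    obtain ⟨hℓp, hℓ3, hℓ2, hℓ9p, hℓP, -, -, -, -, -⟩ := hKolq ℓ hℓ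
    obtain ⟨hm0, hℓm', -, hm3, hℓm3, hpf⟩ := hsplit ℓ m hℓ hℓm
    have hn0 : ℓ * m ≠ 0 := mul_ne_zero hℓp.ne_zero hm0
    have hdiv : 9 * p * (ℓ * m) / ℓ = 9 * p * m := by
      rw [show 9 * p * (ℓ * m) = ℓ * (9 * p * m) by ring, Nat.mul_div_cancel_left _ hℓp.pos]
    have hσ : Subgroup.zpowers (σ (ℓ * m) ℓ) = ringClassGalOver ι (9 * p * (ℓ * m)) (9 * p * m) := by
      rw [← hdiv]
      exact hσgen (ℓ * m) ℓ hn0 hℓp hℓ9p hℓP (dvd_mul_right ℓ m) (by rw [Nat.mul_div_cancel_left m hℓp.pos]; exact hℓm')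
    have hmemt : ∀ a ∈ (((ℓ * m).primeFactors.sort (· ≤ ·)).map fun q ↦ (σ (ℓ * m) q, q)),
        a.2 ∈ (ℓ * m).primeFactors ∧ a = (σ (ℓ * m) a.2, a.2) := by
      intro a ha
      obtain ⟨q, hq, rfl⟩ := List.mem_map.mp ha
      exact ⟨(Finset.mem_sort _).mp hq, rfl⟩
    have hgal : ∀ a ∈ (((ℓ * m).primeFactors.sort (· ≤ ·)).map fun q ↦ (σ (ℓ * m) q, q)),
        a.1 ∈ ringClassGal ι (9 * p * (ℓ * m)) := fun a ha ↦ by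
      rw [(hmemt a ha).2]; exact hσgal _ _
    have hperm0 : ((ℓ * m).primeFactors.sort (· ≤ ·)).Perm (ℓ :: m.primeFactors.sort (· ≤ ·)) :=
      List.perm_of_nodup_nodup_toFinset_eq (Finset.sort_nodup _ _)
        (List.nodup_cons.mpr ⟨fun h ↦ hℓm' (Nat.dvd_of_mem_primeFactors ((Finset.mem_sort _).mp h)), Finset.sort_nodup _ _⟩)
        (by rw [List.toFinset_cons, Finset.sort_toFinset, Finset.sort_toFinset, hpf])
    refine ⟨hσ, hperm0.map _, fun a ha b hb ↦ commute_of_mem_ringClassGal hK (mul_ne_zero h9p hn0) (hgal a ha) (hgal b hb),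
      hgal, ?_⟩
    exact sum_pointGalHom_pow_eq_zero_of_level hω h2 ι Dt hp3 rfl hℓp hℓ3 hℓ2 hm0 hm3 hℓm'
      (fun h ↦ hℓ9p (Dvd.dvd.mul_left h 9)) hσ (hy (ℓ * m) hn0 hℓm3)
  refine ⟨?_, ?_⟩
  · -- ### l.87–92: `2^a • c_A(ℓm) ∈ Sel_λ(A_K) ↔ 2^a • c_B(m) ∈ T_B(λ)`
    intro ℓ m hℓ hℓm _ v hv a
    obtain ⟨hℓp, hℓ3, hℓ2, -, -, -, hℓB, hℓdK, -, hFB⟩ := hKolq ℓ hℓ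
    obtain ⟨hm0, hℓm', hsuppm, hm3, hℓm3, -⟩ := hsplit ℓ m hℓ hℓm
    obtain ⟨hσ, hperm, hc_t, hgal, htr⟩ := htop ℓ m hℓ hℓm
    have hn0 : ℓ * m ≠ 0 := mul_ne_zero hℓp.ne_zero hm0
    have hn1 : ℓ * m ≠ 1 := fun e ↦ hℓp.one_lt.ne' (Nat.eq_one_of_mul_eq_one_right e)
    obtain ⟨hAt, hPAt, ecA⟩ := hcA (ℓ * m) hℓm
    obtain ⟨hBt, -, -⟩ := hcB (ℓ * m) hℓm hn1
    rcases eq_or_ne m 1 with rfl | hm1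
    · -- `m = 1`: the pair `9p ⊂ 9pℓ` of (S2b-A) down to the Kolyvagin bottom class, then the BOTTOM LINK (S3)
      have hle' : ringClassField K ι (9 * p) ≤ ringClassField K ι (9 * p * (ℓ * 1)) :=
        ringClassField_mono hK ι (dvd_mul_right (9 * p) (ℓ * 1)) (mul_ne_zero h9p hn0)
      have hσ' : Subgroup.zpowers (σ (ℓ * 1) ℓ) = ringClassGalOver ι (9 * p * (ℓ * 1)) (9 * p) := by
        rw [show 9 * p * 1 = 9 * p from mul_one _] at hσ; exact hσ
      obtain ⟨-, -, -, hPN₁, -, hN₀n, -, -, -, hAB₁, -, -, hP₁B, -⟩ :=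
        levelDataHalved_sylvesterTower hω h2 ι Dt hp hp3 squarefree_one (mul_one (9 * p)) κ₉ hκG hvBc hvB hvAc hvA0
          hvB3 hvA3 hρ hρρ hlawB hlawA (emb (9 * p)) (hemb _) N₀ hN₀ (s : ringClassField K ι (9 * p) ≃ₐ[K] ringClassField K ι (9 * p))
          (by rw [← Subgroup.coe_mul, hs2, Subgroup.coe_one]) N'' hN''₀ hdich hN''vB hN''vA
          (fun i : ((ringClassField K ι (9 * p) ≃ₐ[K] ringClassField K ι (9 * p)) ⧸ H) × H' ↦ t (i.1, (i.2 : H))) ht'' le_rfl (emb (9 * p)) (hemb _)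
          (fun x ↦ hcoh _ _ _ x) ιe₀ hιe₀ N₀ hN₀ [] (by simp) (by simp [Nat.primeFactors_one]) (by simp) (by simp)
          (by simp) (2 ^ κ * 2 ^ κ) hlev (by simp) (y := y₁) (by simpa only [Nat.cast_one, one_pow, one_mul] using hy₁)
          (s : ringClassField K ι (9 * p) ≃ₐ[K] ringClassField K ι (9 * p)) (fun x ↦ by simp only [show ∀ z : ringClassField K ι (9 * p),
            RingClassField.inclusion ι le_rfl z = z from fun z ↦ Subtype.ext (RingClassField.coe_inclusion ι le_rfl z)]) hsy
      haveI := hN₀n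
      rw [ecA, hcB1]
      exact (pairFlip_upperA_sylvesterTower hω h2 ι hES2 Dt hp hp3 hℓp hℓ3 hℓ2 one_ne_zero hm3 hℓm' (mul_one _) rfl
        hℓB hℓdK hM (2 ^ κ * 2 ^ κ) hlev hFB κ₉ hκG hκ' hvBc hvB hvAc hvA0 hvB3 hvA3 hψB hψA hρ hρρ hlawB hlawA
        hρcomm (emb (9 * p)) N₀ hN₀
        (fun i : ((ringClassField K ι (9 * p) ≃ₐ[K] ringClassField K ι (9 * p)) ⧸ H) × H' ↦ t (i.1, (i.2 : H)))
        le_rfl (emb (9 * p)) (hemb _) (fun x ↦ hcoh _ _ _ x) ιe₀ hιe₀ N₀ hN₀ []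
        (by simpa only [Nat.cast_one, one_pow, one_mul] using hy₁) hPN₁ hle' (emb (9 * p * (ℓ * 1))) (hemb _)
        (fun x ↦ hcoh _ _ _ x) (ιe (ℓ * 1)) (hιe _) (Nf (9 * p * (ℓ * 1))) (hNf _) hσ' _ _ hperm
        (by rw [Nat.primeFactors_one, Finset.sort_empty, List.map_nil]; exact List.Forall₂.nil) hc_t hgal
        (hy (ℓ * 1) hn0 hℓm3) htr hAt hBt hPAt hAB₁ hP₁B v hv ((2 : ℤ) ^ a)).trans
        (bottomLink_halved_sylvesterPair hF hD hC hp h9 h3 A B hA qB qA hqB hqA hne hω h2 CB hCB P Y hPinf hPgen hht hT hY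
          (2 ^ κ * 2 ^ κ) hlev _ ι Dt hdeg y₁ hy₁ (emb (9 * p)) (hemb _) ιe₀ hιe₀ N₀ hN₀ hc₃ hcp H hH Tl hTl t
          ht' ht s H' hH' hsy κ₉ hκG hκ hvBc hvB hvB3 hψB hρ hlawB hρcomm φB fnB hfnB hφB hcoeB hAB₁ hP₁B v ((2 : ℤ) ^ a)).symm
    · -- `m ≠ 1`: the pair `9pm ⊂ 9p(ℓm)` of (S2b-A) between the two defining equations
      have hle₀b : ringClassField K ι (9 * p) ≤ ringClassField K ι (9 * p * m) :=
        ringClassField_mono hK ι (dvd_mul_right (9 * p) m) (mul_ne_zero h9p hm0)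
      have hle_bt : ringClassField K ι (9 * p * m) ≤ ringClassField K ι (9 * p * (ℓ * m)) :=
        ringClassField_mono hK ι (mul_dvd_mul_left (9 * p) (dvd_mul_left m ℓ)) (mul_ne_zero h9p hn0)
      have hcompat : List.Forall₂ (fun (a : (ringClassField K ι (9 * p * (ℓ * m)) ≃ₐ[ℚ] ringClassField K ι (9 * p * (ℓ * m))) × ℕ)
          (b : (ringClassField K ι (9 * p * m) ≃ₐ[ℚ] ringClassField K ι (9 * p * m)) × ℕ) ↦ a.2 = b.2 ∧ ∀ x : ringClassField K ι (9 * p * m),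
          a.1 (RingClassField.inclusion ι hle_bt x) = RingClassField.inclusion ι hle_bt (b.1 x)) ((m.primeFactors.sort (· ≤ ·)).map fun q ↦ (σ (ℓ * m) q, q))
          ((m.primeFactors.sort (· ≤ ·)).map fun q ↦ (σ m q, q)) := by
        rw [List.forall₂_map_left_iff, List.forall₂_map_right_iff, List.forall₂_same]
        exact fun q _ ↦ ⟨rfl, fun x ↦ hσcompat m (ℓ * m) q hm0 hn0 hle_bt x⟩
      obtain ⟨hBb, hPBb, ecB⟩ := hcB m hsuppm hm1
      haveI : (Nf (9 * p * m)).Normal := (hLD m hsuppm).2.1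
      rw [ecA, ecB]
      exact pairFlip_upperA_sylvesterTower hω h2 ι hES2 Dt hp hp3 hℓp hℓ3 hℓ2 hm0 hm3 hℓm' rfl rfl hℓB hℓdK hM
        (2 ^ κ * 2 ^ κ) hlev hFB κ₉ hκG hκ' hvBc hvB hvAc hvA0 hvB3 hvA3 hψB hψA hρ hρρ hlawB hlawA hρcomm
        (emb (9 * p)) N₀ hN₀
        (fun i : ((ringClassField K ι (9 * p) ≃ₐ[K] ringClassField K ι (9 * p)) ⧸ H) × H' ↦ t (i.1, (i.2 : H)))
        hle₀b (emb (9 * p * m)) (hemb _) (fun x ↦ hcoh _ _ _ x) (ιe m) (hιe m)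
        (Nf (9 * p * m)) (hNf _) ((m.primeFactors.sort (· ≤ ·)).map fun q ↦ (σ m q, q)) (hy m hm0 hm3)
        (hLD m hsuppm).1 hle_bt (emb (9 * p * (ℓ * m))) (hemb _) (fun x ↦ hcoh _ _ _ x) (ιe (ℓ * m)) (hιe _)
        (Nf (9 * p * (ℓ * m))) (hNf _) hσ _ _ hperm hcompat hc_t hgal (hy (ℓ * m) hn0 hℓm3) htr hAt hBt hPAt
        hBb hPBb v hv ((2 : ℤ) ^ a)
  · -- ### l.93–98: `2^a • c_B(ℓm) ∈ Sel_λ(B_K) ↔ 2^a • c_A(m) ∈ T_A(λ)` (`m ≠ 1` as `ω(m)` is odd)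
    intro ℓ m hℓ hℓm hodd v hv a
    obtain ⟨hℓp, hℓ3, hℓ2, -, -, hℓA, -, hℓdK, hFA, -⟩ := hKolq ℓ hℓ
    obtain ⟨hm0, hℓm', hsuppm, hm3, hℓm3, -⟩ := hsplit ℓ m hℓ hℓm
    obtain ⟨hσ, hperm, hc_t, hgal, htr⟩ := htop ℓ m hℓ hℓm
    have hn0 : ℓ * m ≠ 0 := mul_ne_zero hℓp.ne_zero hm0
    have hn1 : ℓ * m ≠ 1 := fun e ↦ hℓp.one_lt.ne' (Nat.eq_one_of_mul_eq_one_right e)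
    have hm1 : m ≠ 1 := by
      rintro rfl
      rw [Nat.primeFactors_one, Finset.card_empty] at hodd
      exact (by decide : ¬ Odd 0) hodd
    have hle₀b : ringClassField K ι (9 * p) ≤ ringClassField K ι (9 * p * m) :=
      ringClassField_mono hK ι (dvd_mul_right (9 * p) m) (mul_ne_zero h9p hm0)
    have hle_bt : ringClassField K ι (9 * p * m) ≤ ringClassField K ι (9 * p * (ℓ * m)) :=
      ringClassField_mono hK ι (mul_dvd_mul_left (9 * p) (dvd_mul_left m ℓ)) (mul_ne_zero h9p hn0)
    have hcompat : List.Forall₂ (fun (a : (ringClassField K ι (9 * p * (ℓ * m)) ≃ₐ[ℚ] ringClassField K ι (9 * p * (ℓ * m))) × ℕ)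
          (b : (ringClassField K ι (9 * p * m) ≃ₐ[ℚ] ringClassField K ι (9 * p * m)) × ℕ) ↦ a.2 = b.2 ∧ ∀ x : ringClassField K ι (9 * p * m),
        a.1 (RingClassField.inclusion ι hle_bt x) = RingClassField.inclusion ι hle_bt (b.1 x))
        ((m.primeFactors.sort (· ≤ ·)).map fun q ↦ (σ (ℓ * m) q, q))
        ((m.primeFactors.sort (· ≤ ·)).map fun q ↦ (σ m q, q)) := by
      rw [List.forall₂_map_left_iff, List.forall₂_map_right_iff, List.forall₂_same]
      exact fun q _ ↦ ⟨rfl, fun x ↦ hσcompat m (ℓ * m) q hm0 hn0 hle_bt x⟩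
    obtain ⟨hBt, hPBt, ecB⟩ := hcB (ℓ * m) hℓm hn1
    obtain ⟨hAt, -, -⟩ := hcA (ℓ * m) hℓm
    obtain ⟨hAb, hPAb, ecA⟩ := hcA m hsuppm
    haveI : (Nf (9 * p * m)).Normal := (hLD m hsuppm).2.1
    rw [ecB, ecA]
    exact pairFlip_upperB_sylvesterTower hω h2 ι hES2 Dt hp hp3 hℓp hℓ3 hℓ2 hm0 hm3 hℓm' rfl rfl hℓA hℓdK hM
      (2 ^ κ * 2 ^ κ) hlev hFA κ₉ hκG hκ' hvBc hvB hvAc hvA0 hvB3 hvA3 hψB hψA hρ hρρ hlawB hlawA hρcomm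
      (emb (9 * p)) N₀ hN₀
      (fun i : ((ringClassField K ι (9 * p) ≃ₐ[K] ringClassField K ι (9 * p)) ⧸ H) × H' ↦ t (i.1, (i.2 : H)))
      hle₀b (emb (9 * p * m)) (hemb _) (fun x ↦ hcoh _ _ _ x) (ιe m) (hιe m)
      (Nf (9 * p * m)) (hNf _) ((m.primeFactors.sort (· ≤ ·)).map fun q ↦ (σ m q, q)) (hy m hm0 hm3)
      (hLD m hsuppm).1 hle_bt (emb (9 * p * (ℓ * m))) (hemb _) (fun x ↦ hcoh _ _ _ x) (ιe (ℓ * m)) (hιe _)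
      (Nf (9 * p * (ℓ * m))) (hNf _) hσ _ _ hperm hcompat hc_t hgal (hy (ℓ * m) hn0 hℓm3) htr hAt hBt hPBt
      hAb hPAb v hv ((2 : ℤ) ^ a)

end Summit.BirchSwinnertonDyer.BirchSwinnertonDyer.Theorems.SylvesterTwoCMFlip

end

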